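import Summits.QuantumFields.YangMills.Theorems.ToronCumulantSignOneSiteMoments
import Summits.QuantumFields.YangMills.Theorems.ToronCumulantSignOneSiteFubini
import HarnessLib

/-!
# Route `ToronCumulantSign`, crux `OneSiteCovDerivative` (stmt-QuantumFields-27531) — helper IV:
# the product-Haar expectations of the one-site plaquette energies in literal iterated form

Under product Haar measure `π` on the links (index type `ι`, values in `SU(N)`, `N = 2 + n`), with the commutator energy
`R(X,Y) = Re tr(XYX⁻¹Y⁻¹)`, `w = |tr|²`, and "readers" `A, B ∈ {R, Rᵀ}` (abstractly: continuous, with `∫ A(x,x') dx' = w(x)/N`):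
for four distinct links `a, b, c, d`,
* `E[A(U_a,U_b) B(U_c,U_d) R(U_a,U_c)] = N⁻² ∫∫ w(x) w(y) R(x,y)`   (`integral_reader_PQR`),
* `E[A(U_a,U_b) R(U_a,U_c)] = N⁻¹ ∫∫ w(x) R(x,y)`, `E[B(U_c,U_d) R(U_a,U_c)] = N⁻¹ ∫∫ w(y) R(x,y)`, `E[R(U_a,U_c)] = ∫∫ R`,
* `E[A(U_a,U_b) B(U_c,U_d)] = N⁻²`, `E[A(U_a,U_b)] = N⁻¹`, and the in-plane third moments factor,
all as LITERAL iterated Haar integrals (helpers II, III).  HONEST LABEL: bookkeeping toward the OPEN crux `OneSiteCovDerivative`;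
nothing about the Yang–Mills mass gap.
-/

noncomputable section

open MeasureTheory
open Literature.MathematicalPhysics.QuantumLattice Literature.MathematicalPhysics.QuantumFieldTheory

namespace Summit.QuantumFields.YangMills.Theorems.ToronCumulantSign

section Expect

variable {n : ℕ} {ι : Type*} [Fintype ι]

/-- Local shorthand: `SU(2+n)`. -/
local notation3 (prettyPrint := false) "SUn" => Matrix.specialUnitaryGroup (Fin (2 + n)) ℂ

/-- Local shorthand: the commutator energy `R(X,Y) = Re tr(X Y X⁻¹ Y⁻¹)`. -/
local notation3 (prettyPrint := false) "R" X:max Y:max =>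
  (((X * Y * X⁻¹ * Y⁻¹ : SUn) : Matrix (Fin (2 + n)) (Fin (2 + n)) ℂ).trace.re : ℝ)

/-- Local shorthand: `w(X) = |tr X|²`. -/
local notation3 (prettyPrint := false) "w" X:max =>
  (Complex.normSq (Matrix.trace ((X : SUn) : Matrix (Fin (2 + n)) (Fin (2 + n)) ℂ)) : ℝ)

/-- Local shorthand: Haar probability on `SU(2+n)`. -/
local notation3 (prettyPrint := false) "dH" => haarProbability (Matrix.specialUnitaryGroup (Fin (2 + n)) ℂ)

/-- Local shorthand: product Haar measure on the links. -/
local notation3 (prettyPrint := false) "πH" => Measure.pi (fun _ : ι => haarProbability (Matrix.specialUnitaryGroup (Fin (2 + n)) ℂ))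

omit [Fintype ι] in
/-- Continuity of `z ↦ R(f z, g z)`. [folklore] -/
theorem continuous_R_comp {Z : Type*} [TopologicalSpace Z] {f g : Z → SUn} (hf : Continuous f) (hg : Continuous g) :
    Continuous fun z => R (f z) (g z) := by
  have h : Continuous fun z => (f z * g z * (f z)⁻¹ * (g z)⁻¹ : SUn) := by fun_prop
  exact Complex.continuous_re.comp (continuous_id.matrix_trace.comp (continuous_subtype_val.comp h))

omit [Fintype ι] in
/-- Continuity of `z ↦ w(f z)`. [folklore] -/
theorem continuous_w_comp {Z : Type*} [TopologicalSpace Z] {f : Z → SUn} (hf : Continuous f) :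
    Continuous fun z => w (f z) :=
  Complex.continuous_normSq.comp (continuous_id.matrix_trace.comp (continuous_subtype_val.comp hf))

omit [Fintype ι] in
/-- Continuity of a reader composed with two continuous maps. [folklore] -/
theorem continuous_reader_comp {Z : Type*} [TopologicalSpace Z] {A : SUn → SUn → ℝ} (hA : Continuous (Function.uncurry A))
    {f g : Z → SUn} (hf : Continuous f) (hg : Continuous g) : Continuous fun z => A (f z) (g z) :=
  hA.comp (hf.prodMk hg)

omit [Fintype ι] in
/-- The reader `R` is continuous. [folklore] -/
theorem continuous_uncurry_R : Continuous (Function.uncurry fun X Y : SUn => R X Y) :=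
  continuous_R_comp continuous_fst continuous_snd

omit [Fintype ι] in
/-- The transposed reader `Rᵀ(x,x') = R(x',x)` is continuous. [folklore] -/
theorem continuous_uncurry_Rt : Continuous (Function.uncurry fun X Y : SUn => R Y X) :=
  continuous_R_comp continuous_snd continuous_fst

/-- ★ `E[R(U_a, U_b)] = ∫∫ R = 1/N` for distinct links. [folklore] -/
theorem integral_link_R {a b : ι} (hab : a ≠ b) :
    ∫ U, R (U a) (U b) ∂πH = ∫ x, ∫ y, R x y ∂dH ∂dH := by
  haveI := secondCountableTopology_su' (n := n)
  exact integral_eval_pair hab (fun z : SUn × SUn => R z.1 z.2) (continuous_R_comp continuous_fst continuous_snd)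

/-- ★ Mixed plane: `E[A(U_a,U_b) B(U_c,U_d) R(U_a,U_c)] = N⁻² ∫∫ w w R`. [folklore] -/
theorem integral_link_PQR {A B : SUn → SUn → ℝ} (hAc : Continuous (Function.uncurry A))
    (hBc : Continuous (Function.uncurry B)) (hA : ∀ x, ∫ x', A x x' ∂dH = w x / (2 + n : ℝ))
    (hB : ∀ y, ∫ y', B y y' ∂dH = w y / (2 + n : ℝ)) {a b c d : ι} (hab : a ≠ b) (hcd : c ≠ d) (hac : a ≠ c)
    (had : a ≠ d) (hbc : b ≠ c) (hbd : b ≠ d) :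
    ∫ U, A (U a) (U b) * B (U c) (U d) * R (U a) (U c) ∂πH =
      (1 / (2 + n : ℝ)) ^ 2 * ∫ x, ∫ y, w x * w y * R x y ∂dH ∂dH := by
  haveI := secondCountableTopology_su' (n := n)
  have hF : Continuous fun z : (SUn × SUn) × (SUn × SUn) => A z.1.1 z.1.2 * B z.2.1 z.2.2 * R z.1.1 z.2.1 :=
    ((continuous_reader_comp hAc (continuous_fst.comp continuous_fst) (continuous_snd.comp continuous_fst)).mul
      (continuous_reader_comp hBc (continuous_fst.comp continuous_snd) (continuous_snd.comp continuous_snd))).mul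
      (continuous_R_comp (continuous_fst.comp continuous_fst) (continuous_fst.comp continuous_snd))
  have h := integral_eval_quad hab hcd hac had hbc hbd _ hF
  simp only at h
  rw [h]
  exact iter_mixed_PQR A B hA hB

/-- ★ Mixed plane: `E[A(U_a,U_b) R(U_a,U_c)] = N⁻¹ ∫∫ w(x) R(x,y)`. [folklore] -/
theorem integral_link_PR {A : SUn → SUn → ℝ} (hAc : Continuous (Function.uncurry A))
    (hA : ∀ x, ∫ x', A x x' ∂dH = w x / (2 + n : ℝ)) {a b c d : ι} (hab : a ≠ b) (hcd : c ≠ d) (hac : a ≠ c)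
    (had : a ≠ d) (hbc : b ≠ c) (hbd : b ≠ d) :
    ∫ U, A (U a) (U b) * R (U a) (U c) ∂πH = (1 / (2 + n : ℝ)) * ∫ x, ∫ y, w x * R x y ∂dH ∂dH := by
  haveI := secondCountableTopology_su' (n := n)
  have hF : Continuous fun z : (SUn × SUn) × (SUn × SUn) => A z.1.1 z.1.2 * R z.1.1 z.2.1 :=
    (continuous_reader_comp hAc (continuous_fst.comp continuous_fst) (continuous_snd.comp continuous_fst)).mul
      (continuous_R_comp (continuous_fst.comp continuous_fst) (continuous_fst.comp continuous_snd))
  have h := integral_eval_quad hab hcd hac had hbc hbd _ hF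
  simp only at h
  rw [h]
  exact iter_mixed_PR A hA

/-- ★ Mixed plane: `E[B(U_c,U_d) R(U_a,U_c)] = N⁻¹ ∫∫ w(y) R(x,y)`. [folklore] -/
theorem integral_link_QR {B : SUn → SUn → ℝ} (hBc : Continuous (Function.uncurry B))
    (hB : ∀ y, ∫ y', B y y' ∂dH = w y / (2 + n : ℝ)) {a b c d : ι} (hab : a ≠ b) (hcd : c ≠ d) (hac : a ≠ c)
    (had : a ≠ d) (hbc : b ≠ c) (hbd : b ≠ d) :
    ∫ U, B (U c) (U d) * R (U a) (U c) ∂πH = (1 / (2 + n : ℝ)) * ∫ x, ∫ y, w y * R x y ∂dH ∂dH := by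
  haveI := secondCountableTopology_su' (n := n)
  have hF : Continuous fun z : (SUn × SUn) × (SUn × SUn) => B z.2.1 z.2.2 * R z.1.1 z.2.1 :=
    (continuous_reader_comp hBc (continuous_fst.comp continuous_snd) (continuous_snd.comp continuous_snd)).mul
      (continuous_R_comp (continuous_fst.comp continuous_fst) (continuous_fst.comp continuous_snd))
  have h := integral_eval_quad hab hcd hac had hbc hbd _ hF
  simp only at h
  rw [h]
  exact iter_mixed_QR B hB

/-- ★ `E[A(U_a,U_b) B(U_c,U_d)] = N⁻²` (independent planes). [folklore] -/
theorem integral_link_PQ {A B : SUn → SUn → ℝ} (hAc : Continuous (Function.uncurry A))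
    (hBc : Continuous (Function.uncurry B)) (hA : ∀ x, ∫ x', A x x' ∂dH = w x / (2 + n : ℝ))
    (hB : ∀ y, ∫ y', B y y' ∂dH = w y / (2 + n : ℝ)) {a b c d : ι} (hab : a ≠ b) (hcd : c ≠ d) (hac : a ≠ c)
    (had : a ≠ d) (hbc : b ≠ c) (hbd : b ≠ d) :
    ∫ U, A (U a) (U b) * B (U c) (U d) ∂πH = (1 / (2 + n : ℝ)) ^ 2 := by
  haveI := secondCountableTopology_su' (n := n)
  have hF : Continuous fun z : (SUn × SUn) × (SUn × SUn) => A z.1.1 z.1.2 * B z.2.1 z.2.2 :=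
    (continuous_reader_comp hAc (continuous_fst.comp continuous_fst) (continuous_snd.comp continuous_fst)).mul
      (continuous_reader_comp hBc (continuous_fst.comp continuous_snd) (continuous_snd.comp continuous_snd))
  have h := integral_eval_quad hab hcd hac had hbc hbd _ hF
  simp only at h
  rw [h]
  exact iter_PQ A B hA hB

/-- ★ `E[A(U_a,U_b)] = N⁻¹`. [folklore] -/
theorem integral_link_P {A : SUn → SUn → ℝ} (hAc : Continuous (Function.uncurry A))
    (hA : ∀ x, ∫ x', A x x' ∂dH = w x / (2 + n : ℝ)) {a b : ι} (hab : a ≠ b) :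
    ∫ U, A (U a) (U b) ∂πH = 1 / (2 + n : ℝ) := by
  haveI := secondCountableTopology_su' (n := n)
  have h := integral_eval_pair hab _ hAc
  simp only [Function.uncurry_apply_pair] at h
  rw [h]
  simp_rw [hA, integral_div, integral_w]

/-- In-plane: `E[A(U_a,U_b) B(U_c,U_d) A(U_a,U_b)] = N⁻¹ ∫∫ A²`. [folklore] -/
theorem integral_link_PQP {A B : SUn → SUn → ℝ} (hAc : Continuous (Function.uncurry A))
    (hBc : Continuous (Function.uncurry B)) (hB : ∀ y, ∫ y', B y y' ∂dH = w y / (2 + n : ℝ)) {a b c d : ι} (hab : a ≠ b)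
    (hcd : c ≠ d) (hac : a ≠ c) (had : a ≠ d) (hbc : b ≠ c) (hbd : b ≠ d) :
    ∫ U, A (U a) (U b) * B (U c) (U d) * A (U a) (U b) ∂πH =
      (1 / (2 + n : ℝ)) * ∫ x, ∫ x', A x x' * A x x' ∂dH ∂dH := by
  haveI := secondCountableTopology_su' (n := n)
  have hF : Continuous fun z : (SUn × SUn) × (SUn × SUn) => A z.1.1 z.1.2 * B z.2.1 z.2.2 * A z.1.1 z.1.2 :=
    ((continuous_reader_comp hAc (continuous_fst.comp continuous_fst) (continuous_snd.comp continuous_fst)).mul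
      (continuous_reader_comp hBc (continuous_fst.comp continuous_snd) (continuous_snd.comp continuous_snd))).mul
      (continuous_reader_comp hAc (continuous_fst.comp continuous_fst) (continuous_snd.comp continuous_fst))
  have h := integral_eval_quad hab hcd hac had hbc hbd _ hF
  simp only at h
  rw [h]
  exact iter_PQP A B hB

/-- In-plane: `E[A(U_a,U_b) A(U_a,U_b)] = ∫∫ A²`. [folklore] -/
theorem integral_link_PP {A : SUn → SUn → ℝ} (hAc : Continuous (Function.uncurry A)) {a b : ι} (hab : a ≠ b) :
    ∫ U, A (U a) (U b) * A (U a) (U b) ∂πH = ∫ x, ∫ x', A x x' * A x x' ∂dH ∂dH := by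
  haveI := secondCountableTopology_su' (n := n)
  have hF : Continuous fun z : SUn × SUn => A z.1 z.2 * A z.1 z.2 :=
    (continuous_reader_comp hAc continuous_fst continuous_snd).mul (continuous_reader_comp hAc continuous_fst continuous_snd)
  have h := integral_eval_pair hab _ hF
  simp only at h
  exact h

/-- In-plane: `E[A(U_a,U_b) B(U_c,U_d) B(U_c,U_d)] = N⁻¹ ∫∫ B²`. [folklore] -/
theorem integral_link_PQQ {A B : SUn → SUn → ℝ} (hAc : Continuous (Function.uncurry A))
    (hBc : Continuous (Function.uncurry B)) (hA : ∀ x, ∫ x', A x x' ∂dH = w x / (2 + n : ℝ)) {a b c d : ι} (hab : a ≠ b)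
    (hcd : c ≠ d) (hac : a ≠ c) (had : a ≠ d) (hbc : b ≠ c) (hbd : b ≠ d) :
    ∫ U, A (U a) (U b) * B (U c) (U d) * B (U c) (U d) ∂πH =
      (1 / (2 + n : ℝ)) * ∫ y, ∫ y', B y y' * B y y' ∂dH ∂dH := by
  haveI := secondCountableTopology_su' (n := n)
  have hF : Continuous fun z : (SUn × SUn) × (SUn × SUn) => A z.1.1 z.1.2 * B z.2.1 z.2.2 * B z.2.1 z.2.2 :=
    ((continuous_reader_comp hAc (continuous_fst.comp continuous_fst) (continuous_snd.comp continuous_fst)).mul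
      (continuous_reader_comp hBc (continuous_fst.comp continuous_snd) (continuous_snd.comp continuous_snd))).mul
      (continuous_reader_comp hBc (continuous_fst.comp continuous_snd) (continuous_snd.comp continuous_snd))
  have h := integral_eval_quad hab hcd hac had hbc hbd _ hF
  simp only at h
  rw [h]
  exact iter_PQQ A B hA

end Expect

end Summit.QuantumFields.YangMills.Theorems.ToronCumulantSign
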